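import Literature.Algebra.Homology.InflationRestrictionHigher

/-!
# Inflation along an arbitrary surjection: for `f : G' ↠ G` and `φ : Res_f B ⟶ A` identifying `B` with `A^{ker f}`,
# `Hⁿ(f, φ) : Hⁿ(G, B) → Hⁿ(G', A)` is the inflation up to isomorphism; injective on `Hⁿ⁺¹` when
# `Hⁱ(ker f, A) = 0` for `1 ≤ i ≤ n` (Serre, *Corps locaux* VII §6 Prop. 5, transported)

Topic `Algebra/Homology`; namespace `Literature.Algebra.Homology.InflationRestriction`.  Definitions with bodies (the two
identifications) and theorems; no named fact, no instance, no `sorry`.  Sequel of the tree's `InflationRestrictionHigher`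
(`inflation S A n : Hⁿ(G ⧸ S, A^S) ⟶ Hⁿ(G, A)` on Mathlib's `groupCohomology.map`, `mono_inflation_succ`, `isIso_inflation`),
which treats the quotient presentation `G → G ⧸ S` only.  In applications the surjection is given abstractly — a
restriction map `Gal(E'/F) ↠ Gal(E/F)`, `H_{E'} ↠ H_E` between images of an open subgroup, `U ⧸ (U_{E'} ∩ U) ↠ U ⧸ (U_E ∩ U)`
— together with an INJECTIVE equivariant map `φ : B → A` whose image is the submodule fixed by `ker f` (Galois descent);
this file performs the transport once and for all:

* §1 `hom_mem_invariants_ker` (`φ` lands in `A^{ker f}`), **`kerInvariantsEquiv : B ≃ₗ[k] A^{ker f}`** (from `φ` injective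
  with image the `ker f`-invariants), **`quotKerEquiv : G ≃* G' ⧸ ker f`**, `kerInvariantsEquiv_comp_ρ` (equivariance along
  `quotKerEquiv`), **`mapSurjIso n : Hⁿ(G' ⧸ ker f, A^{ker f}) ≅ Hⁿ(G, B)`** (Mathlib's `groupCohomology.mapIso`);
* §2 **`map_eq_mapSurjIso_inv_comp_inflation`**: `groupCohomology.map f φ n = (mapSurjIso n)⁻¹ ≫ inflation (ker f) A n`;
* §3 **`mono_map_succ_of_surjective`** / **`map_succ_injective_of_surjective`** (`Hⁱ(ker f, A) = 0` for `1 ≤ i ≤ n` ⟹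
  `Hⁿ⁺¹(f, φ)` injective; `n = 1`: `H¹(ker f, A) = 0 ⟹ H²(G, B) ↪ H²(G', A)`), **`isIso_map_of_surjective`** (the
  corollary to Prop. 5: an isomorphism in degrees `1 ≤ i ≤ q - 1` when `Hʲ(ker f, A) = 0` for `1 ≤ j ≤ q - 1`).

Written for brick E3 of lane «PT-Ш-S-TC» (crux `stmt-BirchSwinnertonDyer-19032`, cell bsd-eis, seat bsd-line-x1-p1-w3
gen 18): the relative inflations of the idèle / unit / truncated-idèle layer systems are all `groupCohomology.map` along
such surjections (door-c6 `GalLayerData.relInf`, w3 g17 `restrictHomS`).  HONEST FRAMING: a functoriality statement of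
finite group cohomology; nothing arithmetic is proved here.

## References
* J.-P. Serre, *Local Fields*, GTM 67 (1979), VII §6 Proposition 5 and its Corollary. [Serre1979]
* K. S. Brown, *Cohomology of Groups*, GTM 87 (1982), III §8 (functoriality of `H*(G, –)` in the pair). [Brown1982CohomologyGroups]
-/

noncomputable section

open CategoryTheory CategoryTheory.Limits groupCohomology

namespace Literature.Algebra.Homology

namespace InflationRestriction

universe u

variable {k G G' : Type u} [CommRing k] [Group G] [Group G'] (f : G' →* G) (hf : Function.Surjective f)
  {A : Rep.{u} k G'} {B : Rep.{u} k G} (φ : Rep.res f B ⟶ A)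

/-! ## §1 The identifications `B ≅ A^{ker f}` and `G ≅ G' ⧸ ker f` -/

/-- `φ` lands in the `ker f`-invariants of `A`: `s • φ b = φ (f(s) • b) = φ b` for `s ∈ ker f`.
[cite: Serre1979, VII §6 Proposition 5] -/
theorem hom_mem_invariants_ker (b : B.V) :
    φ.hom.toLinearMap b ∈ Representation.invariants (A.ρ.comp f.ker.subtype) := by
  rintro ⟨s, hs⟩
  change A.ρ s (φ.hom b) = φ.hom b
  rw [← Rep.hom_comm_apply φ s b]
  change φ.hom (B.ρ (f s) b) = φ.hom b
  rw [MonoidHom.mem_ker.1 hs, map_one, Module.End.one_apply]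

variable (hφ : Function.Injective φ.hom.toLinearMap)
  (hA : ∀ a : A.V, (∀ s ∈ f.ker, A.ρ s a = a) → ∃ b : B.V, φ.hom.toLinearMap b = a)

/-- **`B ≃ₗ[k] A^{ker f}`** (the vectors of Mathlib's `A.quotientToInvariants (ker f)`), `b ↦ φ b`: injective because `φ` is,
onto by the descent hypothesis `hA`. [cite: Serre1979, VII §6 Proposition 5] -/
def kerInvariantsEquiv : B.V ≃ₗ[k] (A.quotientToInvariants f.ker).V :=
  LinearEquiv.ofBijective
    ({ toFun := fun b => ⟨φ.hom.toLinearMap b, hom_mem_invariants_ker f φ b⟩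
       map_add' := fun x y => Subtype.ext (φ.hom.toLinearMap.map_add x y)
       map_smul' := fun c x => Subtype.ext (φ.hom.toLinearMap.map_smul c x) } :
      B.V →ₗ[k] (A.quotientToInvariants f.ker).V)
    -- (`Exists.imp`, not `obtain`: destructuring the existential here is pathologically slow for the unifier)
    ⟨fun _ _ hxy => hφ (congrArg Subtype.val hxy), fun a =>
      (hA a.1 fun s hs => a.2 ⟨s, hs⟩).imp fun _ hb => Subtype.ext hb⟩

/-- Formula: the underlying vector of `kerInvariantsEquiv b` is `φ b`. [cite: Serre1979, VII §6 Proposition 5] -/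
theorem coe_kerInvariantsEquiv_apply (b : B.V) :
    ((kerInvariantsEquiv f φ hφ hA b : (A.quotientToInvariants f.ker).V) : A.V) = φ.hom.toLinearMap b := rfl

/-- **`G ≃* G' ⧸ ker f`** (first isomorphism theorem). [cite: Serre1979, VII §6 Proposition 5] -/
def quotKerEquiv : G ≃* G' ⧸ f.ker :=
  (QuotientGroup.quotientKerEquivOfSurjective f hf).symm

/-- `quotKerEquiv (f g) = [g]`. [cite: Serre1979, VII §6 Proposition 5] -/
theorem quotKerEquiv_apply (g : G') : quotKerEquiv f hf (f g) = QuotientGroup.mk g := by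
  apply (quotKerEquiv f hf).symm.injective
  rw [MulEquiv.symm_apply_apply]
  rfl

/-- `(quotKerEquiv)⁻¹ [g] = f g`. [cite: Serre1979, VII §6 Proposition 5] -/
theorem quotKerEquiv_symm_mk (g : G') : (quotKerEquiv f hf).symm (QuotientGroup.mk g) = f g := rfl

/-- **Equivariance**: `b ↦ φ b` intertwines `B`, viewed as a `G' ⧸ ker f`-module along `G' ⧸ ker f ≅ G`, with `A^{ker f}`.
[cite: Serre1979, VII §6 Proposition 5] -/
theorem kerInvariantsEquiv_comp_ρ (q : G' ⧸ f.ker) :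
    (kerInvariantsEquiv f φ hφ hA).toLinearMap ∘ₗ (B.ρ.comp (quotKerEquiv f hf).symm.toMonoidHom) q =
      (A.quotientToInvariants f.ker).ρ q ∘ₗ (kerInvariantsEquiv f φ hφ hA).toLinearMap := by
  induction q using QuotientGroup.induction_on with | H g => ?_
  refine LinearMap.ext fun b => Subtype.ext ?_
  change φ.hom (B.ρ (f g) b) = A.ρ g (φ.hom b)
  exact Rep.hom_comm_apply φ g b

/-- **`Hⁿ(G' ⧸ ker f, A^{ker f}) ≅ Hⁿ(G, B)`** (Mathlib's `groupCohomology.mapIso` along `quotKerEquiv`, `kerInvariantsEquiv`;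
the equivariance of the inverse is derived from `kerInvariantsEquiv_comp_ρ` by
`LinearEquiv.isIntertwining_symm_isIntertwining`). [cite: Serre1979, VII §6 Proposition 5][cite: Brown1982CohomologyGroups, III §8] -/
def mapSurjIso (n : ℕ) : groupCohomology (A.quotientToInvariants f.ker) n ≅ groupCohomology B n :=
  groupCohomology.mapIso (quotKerEquiv f hf).symm (kerInvariantsEquiv f φ hφ hA).symm
    (fun q => LinearEquiv.isIntertwining_symm_isIntertwining
      (ρ := B.ρ.comp (quotKerEquiv f hf).symm.toMonoidHom) (σ := (A.quotientToInvariants f.ker).ρ)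
      (kerInvariantsEquiv_comp_ρ f hf φ hφ hA) q) n

/-! ## §2 `Hⁿ(f, φ) = iso⁻¹ ≫ Inf` -/

/-- **`groupCohomology.map f φ n = (mapSurjIso n)⁻¹ ≫ inflation (ker f) A n`**: the map induced by the pair `(f, φ)` IS the
inflation from `G' ⧸ ker f`, up to the identifications of §1 (both are `groupCohomology.map` along the same homomorphism
`G' → G` with the same underlying map `b ↦ φ b`). [cite: Serre1979, VII §6 Proposition 5][cite: Brown1982CohomologyGroups, III §8] -/
theorem map_eq_mapSurjIso_inv_comp_inflation (n : ℕ) :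
    groupCohomology.map f φ n = (mapSurjIso f hf φ hφ hA n).inv ≫ inflation f.ker A n := by
  unfold mapSurjIso
  rw [groupCohomology.mapIso_inv, ← groupCohomology.map_comp]
  refine groupCohomology.map_congr ?_ ?_ n
  · exact MonoidHom.ext fun _ => rfl
  · exact LinearMap.ext fun _ => rfl

/-! ## §3 Injectivity and bijectivity -/

include hf hφ hA in
/-- **Serre VII §6 Prop. 5 along a surjection**: if `Hⁱ(ker f, A) = 0` for `1 ≤ i ≤ n` then
`Hⁿ⁺¹(f, φ) : Hⁿ⁺¹(G, B) → Hⁿ⁺¹(G', A)` is a monomorphism. [cite: Serre1979, VII §6 Proposition 5] -/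
theorem mono_map_succ_of_surjective (n : ℕ)
    (hS : ∀ i : ℕ, 1 ≤ i → i ≤ n → IsZero (groupCohomology (Rep.res f.ker.subtype A) i)) :
    Mono (groupCohomology.map f φ (n + 1)) := by
  haveI := mono_inflation_succ f.ker A n hS
  rw [map_eq_mapSurjIso_inv_comp_inflation f hf φ hφ hA (n + 1)]
  infer_instance

include hf hφ hA in
/-- **Injectivity, as a function** (the case `n = 1`: `H¹(ker f, A) = 0 ⟹ H²(G, B) ↪ H²(G', A)` is the inflation step of
the Brauer / idèle / idèle-class towers). [cite: Serre1979, VII §6 Proposition 5] -/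
theorem map_succ_injective_of_surjective (n : ℕ)
    (hS : ∀ i : ℕ, 1 ≤ i → i ≤ n → IsZero (groupCohomology (Rep.res f.ker.subtype A) i)) :
    Function.Injective (groupCohomology.map f φ (n + 1)) :=
  (ModuleCat.mono_iff_injective _).1 (mono_map_succ_of_surjective f hf φ hφ hA n hS)

include hf hφ hA in
/-- **The case `n = 1`**: `H¹(ker f, A) = 0 ⟹ H²(f, φ) : H²(G, B) → H²(G', A)` is injective. [cite: Serre1979, VII §6 Proposition 5] -/
theorem map_two_injective_of_surjective (hS : IsZero (groupCohomology (Rep.res f.ker.subtype A) 1)) :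
    Function.Injective (groupCohomology.map f φ 2) :=
  map_succ_injective_of_surjective f hf φ hφ hA 1 fun i hi hi' => by
    obtain rfl : i = 1 := le_antisymm hi' hi
    exact hS

include hf hφ hA in
/-- **Serre VII §6 Corollary to Prop. 5 along a surjection**: if `Hʲ(ker f, A) = 0` for `1 ≤ j ≤ q - 1` then
`Hⁱ(f, φ) : Hⁱ(G, B) → Hⁱ(G', A)` is an isomorphism for `1 ≤ i ≤ q - 1`. [cite: Serre1979, VII §6 Corollary to Proposition 5] -/
theorem isIso_map_of_surjective (q : ℕ)
    (hS : ∀ j : ℕ, 1 ≤ j → j ≤ q - 1 → IsZero (groupCohomology (Rep.res f.ker.subtype A) j))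
    (i : ℕ) (hi : 1 ≤ i) (hiq : i ≤ q - 1) : IsIso (groupCohomology.map f φ i) := by
  haveI := isIso_inflation f.ker A q hS i hi hiq
  rw [map_eq_mapSurjIso_inv_comp_inflation f hf φ hφ hA i]
  infer_instance

end InflationRestriction

end Literature.Algebra.Homology

end
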